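import Summits.QuantumAdvantage.QuantumAdvantage.Theorems.CubicForrelationNearExactIsExactTwelveT1Dead

/-!
# Crux `CubicForrelation.NearExactIsExact` (stmt-QuantumAdvantage-14043) — n = 12: the rung `233/256 = 932/1024` is CLOSED; `θ₁₂ ≤ 932/1024 − 2⁻¹⁴`

Certificate seat `b2b-cforr-cert` (gen 18).  HONEST FRAMING: packaging (standard axioms) of `isolation_twelve_ge_932` (…TwelveT1Dead) with the value
granularity `Φ ∈ 2⁻¹⁴ℤ` (`stub_valueGranularity`): a DECIDABLE VERDICT on the finite ladder at `n = 12` — the value `932/1024` is not attained, so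
`θ₁₂ ∈ [57/64, 14911/16384]`; the 20 values `913/1024, …, 931/1024` (and the finer grid points between them) remain undecided.  NOT summit progress.

* `tw19_gt_14911_eq_one` / `isolation_twelve_gt_14911`: `Φ > 14911/16384 ⇒ Φ = 1` (granularity + `isolation_twelve_ge_932`).
* `theta_twelve_lt_932`: `θ₁₂ ∈ [57/64, 14911/16384]`, `14911/16384 = 932/1024 − 1/16384`.
* `no_window_twelve_ge_932`: no cubic pair on 12 bits has `932/1024 ≤ Φ < 1`.

References: Ax (1964) / McEliece (1972) (value granularity); Kasami–Tokura (1970) is NOT used.  Everything below is proved from Mathlib and the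
tree; axioms are the standard three.
-/

set_option linter.dupNamespace false -- D-0017: single-problem summit ⇒ `QuantumAdvantage.QuantumAdvantage` by design

noncomputable section

namespace Summit.QuantumAdvantage.QuantumAdvantage.Theorems.CubicForrelation.NearExactIsExact

open Finset
open Literature.Computability.QuantumComplexity

/-- **`Φ > 14911/16384 ⇒ Φ = 1`** for cubic pairs on 12 bits: `2¹⁸Φ ∈ 2⁴ℤ` (`stub_valueGranularity`), so `Φ > 932/1024 − 2⁻¹⁴` forces
`Φ ≥ 932/1024`, and `isolation_twelve_ge_932` applies.  NOT summit progress. [this work] -/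
theorem tw19_gt_14911_eq_one (f g : (Fin 12 → Bool) → Bool) (hf : IsDegLeFun 3 f) (hg : IsDegLeFun 3 g)
    (hΦ : (14911 / 16384 : ℝ) < forrelation f g) : forrelation f g = 1 := by
  obtain ⟨z, hz⟩ := stub_valueGranularity stub_axParity 6 f g hg
  norm_num at hz
  have hΦz : forrelation f g = (z : ℝ) / 16384 := by linarith
  have hzr : (14911 : ℝ) < (z : ℝ) := by rw [hΦz] at hΦ; linarith
  have hzi : (14911 : ℤ) < z := by exact_mod_cast hzr
  have hzi' : (14912 : ℤ) ≤ z := by omega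
  have hzr' : (14912 : ℝ) ≤ (z : ℝ) := by exact_mod_cast hzi'
  exact isolation_twelve_ge_932 f g hf hg (by rw [hΦz]; linarith)

/-- **Isolation above `14911/16384`** on 12 bits (packaging). [this work] -/
theorem isolation_twelve_gt_14911 : ∀ f g : (Fin 12 → Bool) → Bool, IsDegLeFun 3 f → IsDegLeFun 3 g →
    (14911 / 16384 : ℝ) < forrelation f g → forrelation f g = 1 :=
  fun f g hf hg h => tw19_gt_14911_eq_one f g hf hg h

/-- **`θ₁₂ ≤ 932/1024 − 2⁻¹⁴`**, i.e. `θ₁₂ ∈ [57/64, 14911/16384]`: the least isolation threshold for cubic pairs on 12 bits is at least the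
record `57/64` (`theta_twelve_bounds`) and at most `14911/16384` (`isolation_twelve_gt_14911`).  The value `233/256 = 932/1024` is NOT attained.
Finite-slice verdict, NOT summit progress. [this work] -/
theorem theta_twelve_lt_932 : ∃ θ₀ : ℝ, 57 / 64 ≤ θ₀ ∧ θ₀ ≤ 14911 / 16384 ∧
    IsLeast {θ : ℝ | ∀ f g : (Fin 12 → Bool) → Bool, IsDegLeFun 3 f → IsDegLeFun 3 g →
      θ < forrelation f g → forrelation f g = 1} θ₀ := by
  obtain ⟨θ₀, hθ₀⟩ := theta_exists 12
  exact ⟨θ₀, theta_twelve_bounds.2 θ₀ hθ₀.1, hθ₀.2 isolation_twelve_gt_14911, hθ₀⟩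

/-- **No cubic pair on 12 bits has `932/1024 ≤ Φ < 1`.** [this work] -/
theorem no_window_twelve_ge_932 : ¬ ∃ f g : (Fin 12 → Bool) → Bool, IsDegLeFun 3 f ∧ IsDegLeFun 3 g ∧
    (932 / 1024 : ℝ) ≤ forrelation f g ∧ forrelation f g < 1 := by
  rintro ⟨f, g, hf, hg, hlo, hhi⟩
  have h := isolation_twelve_ge_932 f g hf hg hlo
  rw [h] at hhi
  exact lt_irrefl _ hhi

end Summit.QuantumAdvantage.QuantumAdvantage.Theorems.CubicForrelation.NearExactIsExact

end
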